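import Literature.MathematicalPhysics.KineticTheory.CollisionTubePairMeanLowerBound
import Literature.MathematicalPhysics.KineticTheory.CollisionTubeVarianceStaticsSharp
import Literature.MathematicalPhysics.KineticTheory.CollisionTubeDecoratedSumVariance
import HarnessLib

/-!
# The W-side static floor of one window at rung 0, in probability (Chebyshev), SHARP in the window, modulo the decorrelation plateau
# (helper file, `--supports stmt-AtomisticToContinuum-13080`)

Crux `JParityClosure.RateFloor` (stmt-AtomisticToContinuum-13080), line `Sketch`, rung-0 stub `stub_staticOpacityFloorRung0`
(c2 lane).  For constant profiles `a, u, θ`, a nonnegative continuous weight `0 ≤ χ ≤ Cχ` on `𝕋³`, a nonnegative bounded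
continuous mark `Ξ` with a relative-speed cutoff at `2L`, window parameter `κ ≥ 0` with `ε_N (1 + 2Lκ) < 1/2`, the STATIC
decorated tube double sum

  `S(z) = Σ_{i ≠ j} χ(xᵢ) · pairTubeMark ε_N κ Ξ i j x v`

(whose ordered would-be pairs of the window of length `κ ε_N` dominate nothing else than the line's would-be sum, see
`JParityClosureRateFloorTubeBridge`) satisfies, under the rung-0 law `G_N` and GIVEN the decorated pair-pair
decorrelation of `P_N = posGibbsMeasure 1 ε_N (N+1)` at level `ζ` (Plateau′ of 13079, specialised to one decoration `h`),

  `G_N {S ≤ m_N − t} ≤ (Cχ² · V_N(ζ)) / t²`     (`measure_tubeSum_le_mean_sub_le`)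

with `m_N = (N+1) N (∫χ) (1 − 16λ) ε_N³ κ Θ̄_Ξ` the mean floor of `CollisionTubePairMeanLowerBound.sum_pair_tubeMark_mean_ge`
and `V_N(ζ) = 64 C² (3+4Lκ)³ (N+1)² v + 2 (N+1)² (16 C² v + 96 (N+1) C² v² + 4 ζ (N+1)² C² v²)`,
`v = (4π/3)((ε_N(1+2Lκ))³ − ε_N³) ≍ ε_N³ κ`, the SHARP variance bound of
`CollisionTubeVarianceStaticsSharp.variance_prod_decoratedTubeSum_le_sharp` transferred to `G_N` by `variance_localGibbsLaw_rung0_eq`.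
With `κ = κ_N = (A/σ)(N+1)^{1/3−b}` and `t ≍ m_N ≍ (N+1) N ε_N³ κ_N`, `V_N / t² = o(1) + O(ζ)` for EVERY window exponent
`b ∈ [1/3, 1]` — the per-window input of the Markov-over-windows device (`JParityClosureRateFloorMarkovWindows`).
Also `measurable_tubeSum`: the static decorated tube sum is measurable on the configuration space.
-/

noncomputable section

open MeasureTheory ProbabilityTheory Set Filter Topology Function
open scoped ENNReal BigOperators

namespace Summit.AtomisticToContinuum.HydrodynamicLimit.Theorems

namespace RateFloorTubeChebyshevSharp

open Literature.Analysis.FluidPDE Literature.MathematicalPhysics.KineticTheory Literature.Probability.Moments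

/-- **The one-window W-side floor in probability at rung 0 (Chebyshev), sharp in the window, modulo the decorated
pair-pair decorrelation of the canonical hard-sphere measure.**  See the module docstring. [folklore] -/
theorem measure_tubeSum_le_mean_sub_le_sharp {σ a θ : ℝ} {u : V3} {N : ℕ}
    (Φ : HardSphereFlow (Torus.geometry (Fin 3)) (hsDiameter σ N) (N + 1))
    (hsd : SmallDensity uniformProfile σ) (hN : 1 ≤ N) (ha : 0 < a) (hθ : 0 < θ)
    {χ : T3 → ℝ} (hχ : Continuous χ) (hχ0 : ∀ y, 0 ≤ χ y) {Cχ : ℝ} (hCχ : 0 < Cχ) (hχC : ∀ y, χ y ≤ Cχ)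
    {Ξ : V3 × V3 × V3 → ℝ} (hΞc : Continuous Ξ) {C : ℝ} (hCpos : 0 < C) (hΞC : ∀ p, |Ξ p| ≤ C) (hΞ0 : ∀ p, 0 ≤ Ξ p)
    {L κ : ℝ} (hL : 0 ≤ L) (hκ : 0 ≤ κ) (hΞL : ∀ m v v' : V3, 2 * L ≤ ‖v - v'‖ → Ξ (m, v, v') = 0)
    (hsmall : hsDiameter σ N * (1 + 2 * L * κ) < 1 / 2) {ζ : ℝ} (hζ : 0 ≤ ζ)
    (hdec : ∀ h : T3 → ℝ, Measurable h → (∀ y, |h y| ≤ 1) →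
      ∀ i j i' j' : Fin (N + 1), i ≠ j → i ≠ i' → i ≠ j' → j ≠ i' → j ≠ j' → i' ≠ j' →
      ∀ T T' : Set T3, MeasurableSet T → MeasurableSet T' →
      |(∫ x, h (x i) * T.indicator (fun _ => (1 : ℝ)) (x j - x i) * (h (x i') * T'.indicator (fun _ => (1 : ℝ)) (x j' - x i'))
          ∂posGibbsMeasure (fun _ : T3 => (1 : ℝ)) (hsDiameter σ N) (N + 1)) -
        (∫ x, h (x i) * T.indicator (fun _ => (1 : ℝ)) (x j - x i) ∂posGibbsMeasure (fun _ : T3 => (1 : ℝ)) (hsDiameter σ N) (N + 1)) *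
        (∫ x, h (x i') * T'.indicator (fun _ => (1 : ℝ)) (x j' - x i') ∂posGibbsMeasure (fun _ : T3 => (1 : ℝ)) (hsDiameter σ N) (N + 1))|
        ≤ ζ * (volume T).toReal * (volume T').toReal)
    {t : ℝ} (ht : 0 < t) :
    localGibbsLaw σ (fun _ => a) (fun _ => u) (fun _ => θ) N Φ
        {z | (∑ i : Fin (N + 1), ∑ j : Fin (N + 1),
            (if i ≠ j then χ (z i).1 * pairTubeMark (hsDiameter σ N) κ Ξ i j (fun m => (z m).1) (fun m => (z m).2) else 0)) ≤
          ((N + 1 : ℕ) : ℝ) * N * ((∫ y, χ y) * ((1 - 16 * ovDensity uniformProfile σ) * hsDiameter σ N ^ 3 * κ *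
            ∫ p : V3 × V3, sphereMark Ξ p.1 p.2 * (localMaxwellian 1 θ u p.1 * localMaxwellian 1 θ u p.2))) - t} ≤
      ENNReal.ofReal (Cχ ^ 2 * (64 * C ^ 2 * (3 + 4 * L * κ) ^ 3 * ((N + 1 : ℕ) : ℝ) ^ 2 *
          (4 / 3 * Real.pi * ((hsDiameter σ N * (1 + 2 * L * κ)) ^ 3 - hsDiameter σ N ^ 3)) +
        2 * (((N + 1 : ℕ) : ℝ) ^ 2 * (16 * C ^ 2 * (4 / 3 * Real.pi * ((hsDiameter σ N * (1 + 2 * L * κ)) ^ 3 - hsDiameter σ N ^ 3)) +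
          96 * ((N + 1 : ℕ) : ℝ) * C ^ 2 * (4 / 3 * Real.pi * ((hsDiameter σ N * (1 + 2 * L * κ)) ^ 3 - hsDiameter σ N ^ 3)) ^ 2 +
          4 * ζ * ((N + 1 : ℕ) : ℝ) ^ 2 * C ^ 2 *
            (4 / 3 * Real.pi * ((hsDiameter σ N * (1 + 2 * L * κ)) ^ 3 - hsDiameter σ N ^ 3)) ^ 2))) / t ^ 2) := by
  have hσ2 : σ ≤ 1 / 2 := hsd.σ_lt_half.le
  haveI hGprob : IsProbabilityMeasure (localGibbsLaw σ (fun _ => a) (fun _ => u) (fun _ => θ) N Φ) :=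
    isProbabilityMeasure_localGibbsLaw continuous_const continuous_const continuous_const
      (fun _ => ha) (fun _ => hθ) hσ2 N Φ
  set G := localGibbsLaw σ (fun _ => a) (fun _ => u) (fun _ => θ) N Φ with hGdef
  set Vb : ℝ := 64 * C ^ 2 * (3 + 4 * L * κ) ^ 3 * ((N + 1 : ℕ) : ℝ) ^ 2 *
          (4 / 3 * Real.pi * ((hsDiameter σ N * (1 + 2 * L * κ)) ^ 3 - hsDiameter σ N ^ 3)) +
        2 * (((N + 1 : ℕ) : ℝ) ^ 2 * (16 * C ^ 2 * (4 / 3 * Real.pi * ((hsDiameter σ N * (1 + 2 * L * κ)) ^ 3 - hsDiameter σ N ^ 3)) +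
          96 * ((N + 1 : ℕ) : ℝ) * C ^ 2 * (4 / 3 * Real.pi * ((hsDiameter σ N * (1 + 2 * L * κ)) ^ 3 - hsDiameter σ N ^ 3)) ^ 2 +
          4 * ζ * ((N + 1 : ℕ) : ℝ) ^ 2 * C ^ 2 *
            (4 / 3 * Real.pi * ((hsDiameter σ N * (1 + 2 * L * κ)) ^ 3 - hsDiameter σ N ^ 3)) ^ 2)) with hVb
  set m : ℝ := ((N + 1 : ℕ) : ℝ) * N * ((∫ y, χ y) * ((1 - 16 * ovDensity uniformProfile σ) * hsDiameter σ N ^ 3 * κ *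
    ∫ p : V3 × V3, sphereMark Ξ p.1 p.2 * (localMaxwellian 1 θ u p.1 * localMaxwellian 1 θ u p.2))) with hm
  -- the observable
  set S : Config (N + 1) (Fin 3) T3 → ℝ := fun z => ∑ i : Fin (N + 1), ∑ j : Fin (N + 1),
    (if i ≠ j then χ (z i).1 * pairTubeMark (hsDiameter σ N) κ Ξ i j (fun m => (z m).1) (fun m => (z m).2) else 0) with hS
  -- the normalised decoration and the decorated tube sum on the product space
  set h : T3 → ℝ := fun y => χ y / Cχ with hh
  have hhm : Measurable h := hχ.measurable.div_const Cχ
  have hh1 : ∀ y, |h y| ≤ 1 := fun y => by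
    simp only [hh]
    rw [abs_div, abs_of_pos hCχ, div_le_one hCχ, abs_of_nonneg (hχ0 y)]
    exact hχC y
  set Sh : (Fin (N + 1) → T3) × (Fin (N + 1) → V3) → ℝ := fun p => ∑ i : Fin (N + 1), ∑ j : Fin (N + 1),
    (if i ≠ j then h (p.1 i) * pairTubeMark (hsDiameter σ N) κ Ξ i j p.1 p.2 else 0) with hSh
  have hShm : Measurable Sh := measurable_decoratedTubeSum (hsDiameter σ N) κ hΞc.measurable hhm
  -- `S ∘ zipConfig = Cχ · Sh`
  have hzip : ∀ p, S (zipConfig p) = Cχ * Sh p := fun p => by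
    have h1 : (fun m => (zipConfig p m).1) = p.1 := rfl
    have h2 : (fun m => (zipConfig p m).2) = p.2 := rfl
    simp only [hS, hSh]
    rw [h1, h2, Finset.mul_sum]
    refine Finset.sum_congr rfl fun i _ => ?_
    rw [Finset.mul_sum]
    refine Finset.sum_congr rfl fun j _ => ?_
    split_ifs with hij
    · simp only [hh, zipConfig_apply]
      field_simp
    · rw [mul_zero]
  have hzipf : (fun p => S (zipConfig p)) = fun p => Cχ * Sh p := funext hzip
  have hSzm : Measurable fun p => S (zipConfig p) := by rw [hzipf]; exact hShm.const_mul Cχ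
  have hSm : Measurable S := by
    have hAe : S = (fun p => S (zipConfig p)) ∘ (MeasurableEquiv.arrowProdEquivProdArrow T3 V3 (Fin (N + 1))) := by
      funext z; simp only [comp_apply, zipConfig, MeasurableEquiv.symm_apply_apply]
    rw [hAe]; exact hSzm.comp (MeasurableEquiv.measurable _)
  -- the variance under `G`
  have hvar : variance S G ≤ Cχ ^ 2 * Vb := by
    rw [hGdef, variance_localGibbsLaw_rung0_eq σ ha hθ u N Φ hSzm, hzipf, variance_const_mul]
    refine mul_le_mul_of_nonneg_left ?_ (sq_nonneg _)
    exact variance_prod_decoratedTubeSum_le_sharp hsd hN hΞc.measurable hCpos hΞC hL hκ hΞL hsmall hhm hh1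
      (gaussMeasure u θ) hζ (hdec h hhm hh1)
  -- the mean under `G`
  have hmean : m ≤ ∫ z, S z ∂G := sum_pair_tubeMark_mean_ge Φ hsd ha hθ hχ hχ0 hΞc hΞC hΞ0 hL hκ hΞL hsmall
  -- `S` is bounded, hence square integrable
  have hterm : ∀ (z : Config (N + 1) (Fin 3) T3) (i j : Fin (N + 1)),
      |(if i ≠ j then χ (z i).1 * pairTubeMark (hsDiameter σ N) κ Ξ i j (fun m => (z m).1) (fun m => (z m).2) else 0)| ≤
        Cχ * C := fun z i j => by
    split_ifs
    · rw [abs_mul, abs_of_nonneg (hχ0 _)]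
      exact mul_le_mul (hχC _) (abs_pairTubeMark_le (hsDiameter σ N) κ hΞC i j _ _) (abs_nonneg _) hCχ.le
    · rw [abs_zero]; exact mul_nonneg hCχ.le hCpos.le
  have hSb : ∀ z, |S z| ≤ (N + 1 : ℕ) * ((N + 1 : ℕ) * (Cχ * C)) := fun z => by
    refine (Finset.abs_sum_le_sum_abs _ _).trans ?_
    calc ∑ i : Fin (N + 1), |∑ j : Fin (N + 1),
            (if i ≠ j then χ (z i).1 * pairTubeMark (hsDiameter σ N) κ Ξ i j (fun m => (z m).1) (fun m => (z m).2) else 0)|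
        ≤ ∑ _i : Fin (N + 1), ((N + 1 : ℕ) * (Cχ * C)) := Finset.sum_le_sum fun i _ =>
          (Finset.abs_sum_le_sum_abs _ _).trans ((Finset.sum_le_sum fun j _ => hterm z i j).trans (by
            rw [Finset.sum_const, Finset.card_univ, Fintype.card_fin, nsmul_eq_mul]))
      _ = (N + 1 : ℕ) * ((N + 1 : ℕ) * (Cχ * C)) := by
          rw [Finset.sum_const, Finset.card_univ, Fintype.card_fin, nsmul_eq_mul]
  have hS2 : MemLp S 2 G :=
    MemLp.of_bound hSm.aestronglyMeasurable _ (ae_of_all _ fun z => (Real.norm_eq_abs _).trans_le (hSb z))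
  -- Chebyshev
  have hcheb := meas_ge_le_variance_div_sq hS2 ht
  have hsub : {z | S z ≤ m - t} ⊆ {z | t ≤ |S z - ∫ z, S z ∂G|} := fun z hz => by
    simp only [mem_setOf_eq] at hz ⊢
    rw [abs_sub_comm]
    exact (by linarith : t ≤ (∫ z, S z ∂G) - S z).trans (le_abs_self _)
  calc G {z | S z ≤ m - t} ≤ G {z | t ≤ |S z - ∫ z, S z ∂G|} := measure_mono hsub
    _ ≤ ENNReal.ofReal (variance S G / t ^ 2) := hcheb
    _ ≤ ENNReal.ofReal (Cχ ^ 2 * Vb / t ^ 2) :=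
        ENNReal.ofReal_le_ofReal (div_le_div_of_nonneg_right hvar (sq_nonneg _))

/-- The static decorated tube sum `z ↦ Σ_{i≠j} χ(xᵢ) pairTubeMark ε κ Ξ i j x v` is measurable on the configuration space
(continuous `χ`, continuous `Ξ`). [folklore] -/
theorem measurable_tubeSum {N : ℕ} (ε κ : ℝ) {χ : T3 → ℝ} (hχ : Continuous χ) {Ξ : V3 × V3 × V3 → ℝ} (hΞc : Continuous Ξ) :
    Measurable fun z : Config (N + 1) (Fin 3) T3 => ∑ i : Fin (N + 1), ∑ j : Fin (N + 1),
      (if i ≠ j then χ (z i).1 * pairTubeMark ε κ Ξ i j (fun m => (z m).1) (fun m => (z m).2) else 0) := by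
  refine Finset.measurable_sum _ fun i _ => Finset.measurable_sum _ fun j _ => ?_
  by_cases hij : i ≠ j
  · simp only [if_pos hij]
    have h0 : Measurable fun z : Config (N + 1) (Fin 3) T3 => (z i).1 := (measurable_pi_apply i).fst
    exact (hχ.measurable.comp h0).mul (measurable_pairTubeMark_config ε κ hΞc.measurable i j)
  · simp only [if_neg hij]; exact measurable_const

/-- Registered stub `stub_tubeChebyshevSharpRung0` of crux stmt-AtomisticToContinuum-13080 (line `Sketch`, c2 lane): the closed form of
`measure_tubeSum_le_mean_sub_le_sharp`. -/
theorem stub_tubeChebyshevSharpRung0 : ∀ (σ a θ : ℝ) (u : V3) (N : ℕ) (Φ : HardSphereFlow (Torus.geometry (Fin 3)) (hsDiameter σ N) (N + 1)), SmallDensity uniformProfile σ → 1 ≤ N → 0 < a → 0 < θ → ∀ (χ : T3 → ℝ), Continuous χ → (∀ y, 0 ≤ χ y) → ∀ (Cχ : ℝ), 0 < Cχ → (∀ y, χ y ≤ Cχ) → ∀ (Ξ : V3 × V3 × V3 → ℝ), Continuous Ξ → ∀ (C : ℝ), 0 < C → (∀ p, |Ξ p| ≤ C) → (∀ p, 0 ≤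 Ξ p) → ∀ (L κ : ℝ), 0 ≤ L → 0 ≤ κ → (∀ m v v' : V3, 2 * L ≤ ‖v - v'‖ → Ξ (m, v, v') = 0) → hsDiameter σ N * (1 + 2 * L * κ) < 1 / 2 → ∀ (ζ : ℝ), 0 ≤ ζ → (∀ h : T3 → ℝ, Measurable h → (∀ y, |h y| ≤ 1) → ∀ i j i' j' : Fin (N + 1), i ≠ j → i ≠ i' → i ≠ j' → j ≠ i' → j ≠ j' → i' ≠ j' → ∀ T T' : Set T3, MeasurableSet T → MeasurableSet T' → |(∫ x, h (x i) * T.indicator (fun _ => (1 : ℝ)) (x j - x i) * (h (x i') * T'.indicator (fun _ => (1 : ℝ)) (x j' - x i')) ∂posGibbsMeasure (fun _ : T3 => (1 : ℝ)) (hsDiameter σ N) (N + 1)) - (∫ x, h (x i) * T.indicator (fun _ => (1 : ℝ)) (x j - x i) ∂posGibbsMeasure (fun _ : T3 => (1 : ℝ)) (hsDiameter σ N) (N + 1)) * (∫ x, h (x i') * T'.indicator (fun _ => (1 : ℝ)) (x j' - x i') ∂posGibbsMeasure (fun _ : T3 => (1 : ℝ)) (hsDiameter σ N) (N + 1))| ≤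 ζ * (volume T).toReal * (volume T').toReal) → ∀ (t : ℝ), 0 < t → localGibbsLaw σ (fun _ => a) (fun _ => u) (fun _ => θ) N Φ {z | (∑ i : Fin (N + 1), ∑ j : Fin (N + 1), (if i ≠ j then χ (z i).1 * pairTubeMark (hsDiameter σ N) κ Ξ i j (fun m => (z m).1) (fun m => (z m).2) else 0)) ≤ ((N + 1 : ℕ) : ℝ) * N * ((∫ y, χ y) * ((1 - 16 * ovDensity uniformProfile σ) * hsDiameter σ N ^ 3 * κ * ∫ p : V3 × V3, sphereMark Ξ p.1 p.2 * (localMaxwellian 1 θ u p.1 * localMaxwellian 1 θ u p.2))) - t} ≤ ENNReal.ofReal (Cχ ^ 2 * (64 * C ^ 2 * (3 + 4 * L * κ) ^ 3 * ((N + 1 : ℕ) : ℝ) ^ 2 * (4 / 3 * Real.pi * ((hsDiameter σ N * (1 + 2 * L * κ)) ^ 3 - hsDiameter σ N ^ 3)) + 2 * (((N + 1 : ℕ) : ℝ) ^ 2 * (16 * C ^ 2 * (4 / 3 * Real.pi * ((hsDiameter σ N * (1 + 2 * L * κ)) ^ 3 - hsDiameter σ N ^ 3)) + 96 * ((N + 1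 : ℕ) : ℝ) * C ^ 2 * (4 / 3 * Real.pi * ((hsDiameter σ N * (1 + 2 * L * κ)) ^ 3 - hsDiameter σ N ^ 3)) ^ 2 + 4 * ζ * ((N + 1 : ℕ) : ℝ) ^ 2 * C ^ 2 * (4 / 3 * Real.pi * ((hsDiameter σ N * (1 + 2 * L * κ)) ^ 3 - hsDiameter σ N ^ 3)) ^ 2))) / t ^ 2) :=
  fun _σ _a _θ _u _N Φ hsd hN ha hθ _χ hχ hχ0 _Cχ hCχ hχC _Ξ hΞc _C hCpos hΞC hΞ0 _L _κ hL hκ hΞL hsmall _ζ hζ hdec _t ht =>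
    measure_tubeSum_le_mean_sub_le_sharp Φ hsd hN ha hθ hχ hχ0 hCχ hχC hΞc hCpos hΞC hΞ0 hL hκ hΞL hsmall hζ hdec ht

end RateFloorTubeChebyshevSharp

end Summit.AtomisticToContinuum.HydrodynamicLimit.Theorems

end
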